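import Literature.Analysis.ValidatedNumerics.IntervalFunctions
import Literature.Analysis.ValidatedNumerics.MatrixEigenEnclosure
import HarnessLib

/-!
# Certified eigenvalue scans of matrices with `RExpr` entries over a box of parameters

Topic `Literature/Analysis/ValidatedNumerics`. The END-TO-END form of the parametric eigen-enclosure
certificates of `MatrixEigenEnclosure.lean` for families whose entries are terms of the language
`RExpr` (`IntervalFunctions.lean`: rational operations, `|·|`, `x²`, `x⁻¹`, `√·`, `min`, `max`) in
the box variables — e.g. a stiffness / Hessian matrix of a pair potential as a function of the cell
moduli (distances are `√` of quadratics), or a Bloch symbol written in the variables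
`cᵢ = cos kᵢ, sᵢ = sin kᵢ` (the box `[-1,1]^{2d}` over-approximates the torus, so a bound certified on
the box holds on the torus). The consumer supplies ONLY DATA: the entry tables, the box, and a
kd-tree whose leaves carry `(C, Δ, LDLCert, (precision, Heron steps))`; the entry-enclosure check
`rexprEntryOK` (interval evaluation of every entry on the leaf box, compared with `C ± Δ`) and the
eigenvalue check are run by the kernel, and the theorems below conclude, for EVERY parameter `k` of
the box, `lam ≤ λᵢ(A k)` (symmetric real tables), `lam ≤ λᵢ(H k)` (Hermitian tables `Ere + i Eim`),
or the form bounds without any symmetry hypothesis.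

* `eget`, `rexprMatrix n E k`, `rexprMatrixC n Ere Eim k`;
* `rexprEntryOK`, `rexprEntryOK_sound`; `rexprEntryOKC`, `rexprEntryOKC_sound`;
* **`le_eigenvalues_rexprMatrix_of_kdCheck`**, `mul_dotProduct_le_rexprMatrix_of_kdCheck`,
  **`le_eigenvalues_rexprMatrixC_of_kdCheck`**, `mul_normSq_le_re_rexprMatrixC_of_kdCheck`;
* `symmTable`/`isHermitian_rexprMatrix` (symmetry of the real table, decidable syntactically).

Everything here is proved; no named facts.
-/

noncomputable section

open Finset Matrix NonemptyInterval

namespace Literature.Analysis.ValidatedNumerics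

/-! ### Entry tables -/

/-- Entry `(i, j)` of a table of terms (the constant `0` beyond the stored range). [folklore] -/
def eget (E : List (List RExpr)) (i j : ℕ) : RExpr := (E.getD i []).getD j (.const 0)

/-- The real matrix family `k ↦ (E i j)(k)` of an `n × n` table of terms. [folklore] -/
def rexprMatrix (n : ℕ) (E : List (List RExpr)) (k : ℕ → ℝ) : Matrix (Fin n) (Fin n) ℝ :=
  fun i j ↦ (eget E i j).eval k

/-- The complex matrix family `k ↦ (Ere i j)(k) + i (Eim i j)(k)`. [folklore] -/
def rexprMatrixC (n : ℕ) (Ere Eim : List (List RExpr)) (k : ℕ → ℝ) : Matrix (Fin n) (Fin n) ℂ :=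
  fun i j ↦ ((eget Ere i j).eval k : ℂ) + ((eget Eim i j).eval k : ℂ) * Complex.I

/-! ### The entry-enclosure checks -/

/-- Deviation of an enclosure from a centre: `max |I.fst − c| |I.snd − c|` bounds `|x − c|` for all
`x ∈ I`. [folklore] -/
def devQ (I : NonemptyInterval ℚ) (c : ℚ) : ℚ := max |I.fst - c| |I.snd - c|

/-- `|x − c| ≤ devQ I c` for `x ∈ I`. [folklore] -/
theorem abs_sub_le_devQ {I : NonemptyInterval ℚ} {c : ℚ} {x : ℝ} (hx : x ∈ I.ratCast ℝ) :
    |x - c| ≤ (devQ I c : ℝ) := by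
  rw [mem_ratCast_iff] at hx
  unfold devQ
  push_cast
  rw [abs_le]
  constructor
  · have h1 : -(max |(I.fst : ℝ) - c| |(I.snd : ℝ) - c|) ≤ (I.fst : ℝ) - c :=
      (neg_le_neg (le_max_left _ _)).trans (neg_abs_le _)
    linarith [hx.1]
  · have h2 : (I.snd : ℝ) - c ≤ max |(I.fst : ℝ) - c| |(I.snd : ℝ) - c| :=
      (le_abs_self _).trans (le_max_right _ _)
    linarith [hx.2]

/-- Entry check for a REAL table on the leaf box: every entry's enclosure (precision `l.aux.1`,
`l.aux.2` Heron steps) deviates from `C i j` by at most `Δ i j`. [folklore] -/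
def rexprEntryOK (n : ℕ) (E : List (List RExpr)) (B : Box) (l : SymLeaf (ℕ × ℕ)) : Bool :=
  rall n fun i ↦ rall n fun j ↦
    match (eget E i j).enclose l.aux.1 l.aux.2 B.toIvl with
    | some I => decide (devQ I (mget l.C i j) ≤ mget l.Δ i j)
    | none => false

/-- **Soundness of the real entry check.** [folklore] -/
theorem rexprEntryOK_sound {n : ℕ} {E : List (List RExpr)} {B : Box} {l : SymLeaf (ℕ × ℕ)}
    (h : rexprEntryOK n E B l = true) (k : ℕ → ℝ) (hk : B.mem k) (i j : Fin n) :
    |rexprMatrix n E k i j - mreal l.C i j| ≤ mreal l.Δ i j := by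
  have h1 := of_rall (of_rall h i.isLt) j.isLt
  revert h1
  split
  · rename_i I hI
    intro h1
    rw [decide_eq_true_eq] at h1
    have hm := RExpr.eval_mem_enclose (fun i ↦ Box.mem_toIvl hk i) _ hI
    refine (abs_sub_le_devQ hm).trans ?_
    unfold mreal
    exact_mod_cast h1
  · intro h1
    exact absurd h1 Bool.false_ne_true

/-- Entry check for a COMPLEX table `Ere + i Eim`: the deviations of the real and imaginary
enclosures add up to at most `Δ i j` (so that the modulus deviation is `≤ Δ i j`). [folklore] -/
def rexprEntryOKC (n : ℕ) (Ere Eim : List (List RExpr)) (B : Box) (l : HermLeaf (ℕ × ℕ)) : Bool :=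
  rall n fun i ↦ rall n fun j ↦
    match (eget Ere i j).enclose l.aux.1 l.aux.2 B.toIvl, (eget Eim i j).enclose l.aux.1 l.aux.2 B.toIvl with
    | some I, some J => decide (devQ I (mget l.Cre i j) + devQ J (mget l.Cim i j) ≤ mget l.Δ i j)
    | _, _ => false

/-- **Soundness of the complex entry check.** [folklore] -/
theorem rexprEntryOKC_sound {n : ℕ} {Ere Eim : List (List RExpr)} {B : Box} {l : HermLeaf (ℕ × ℕ)}
    (h : rexprEntryOKC n Ere Eim B l = true) (k : ℕ → ℝ) (hk : B.mem k) (i j : Fin n) :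
    ‖rexprMatrixC n Ere Eim k i j - centreC l.Cre l.Cim i j‖ ≤ mreal l.Δ i j := by
  have h1 := of_rall (of_rall h i.isLt) j.isLt
  revert h1
  split
  · rename_i I J hI hJ
    intro h1
    rw [decide_eq_true_eq] at h1
    have hmI := abs_sub_le_devQ (c := mget l.Cre i j) (RExpr.eval_mem_enclose (fun i ↦ Box.mem_toIvl hk i) _ hI)
    have hmJ := abs_sub_le_devQ (c := mget l.Cim i j) (RExpr.eval_mem_enclose (fun i ↦ Box.mem_toIvl hk i) _ hJ)
    have e : rexprMatrixC n Ere Eim k i j - centreC l.Cre l.Cim i j =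
        (((eget Ere i j).eval k - mget l.Cre i j : ℝ) : ℂ) +
          (((eget Eim i j).eval k - mget l.Cim i j : ℝ) : ℂ) * Complex.I := by
      simp only [rexprMatrixC, centreC, mreal]
      push_cast
      ring
    rw [e]
    refine (norm_add_le _ _).trans ?_
    rw [Complex.norm_real, norm_mul, Complex.norm_real, Complex.norm_I, mul_one, Real.norm_eq_abs,
      Real.norm_eq_abs]
    refine le_trans (add_le_add hmI hmJ) ?_
    unfold mreal
    exact_mod_cast h1
  · intro h1
    exact absurd h1 Bool.false_ne_true

/-! ### Symmetry of a real table -/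

/-- The table is syntactically symmetric on the block. [folklore] -/
def symmTable (n : ℕ) (E : List (List RExpr)) : Bool :=
  rall n fun i ↦ rall n fun j ↦ decide (eget E i j = eget E j i)

/-- A syntactically symmetric table gives symmetric matrices. [folklore] -/
theorem isHermitian_rexprMatrix {n : ℕ} {E : List (List RExpr)} (h : symmTable n E = true) (k : ℕ → ℝ) :
    (rexprMatrix n E k).IsHermitian := by
  refine Matrix.IsHermitian.ext fun i j ↦ ?_
  have h1 := of_rall (of_rall h j.isLt) i.isLt
  rw [decide_eq_true_eq] at h1
  simp only [rexprMatrix, star_trivial]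
  rw [h1]

/-! ### The scan theorems -/

/-- **Certified eigenvalue scan (real symmetric `RExpr` family).** If every `A k = rexprMatrix n E k`
is symmetric and a kd-tree of `SymLeaf` data passes
`KdCert.check (symLeafOK n (rexprEntryOK n E) lam)` on the box `B`, then `lam ≤ λᵢ(A k)` for every
`k ∈ B` and every `i`. [folklore] -/
theorem le_eigenvalues_rexprMatrix_of_kdCheck {n : ℕ} {E : List (List RExpr)}
    (hsymm : ∀ k, (rexprMatrix n E k).IsHermitian) {lam : ℚ} {B : Box} {t : KdCert (SymLeaf (ℕ × ℕ))}
    (h : t.check (symLeafOK n (rexprEntryOK n E) lam) B = true) (k : ℕ → ℝ) (hk : B.mem k) (i : Fin n) :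
    (lam : ℝ) ≤ (hsymm k).eigenvalues i :=
  le_eigenvalues_on_box_of_kdCheck_real hsymm (fun _ _ hl k hk i j ↦ rexprEntryOK_sound hl k hk i j)
    h k hk i

/-- **Certified form scan (real `RExpr` family, no symmetry needed)**: `lam · (v ⬝ᵥ v) ≤ v ⬝ᵥ A k v`
for every `k ∈ B`. [folklore] -/
theorem mul_dotProduct_le_rexprMatrix_of_kdCheck {n : ℕ} {E : List (List RExpr)} {lam : ℚ} {B : Box}
    {t : KdCert (SymLeaf (ℕ × ℕ))} (h : t.check (symLeafOK n (rexprEntryOK n E) lam) B = true)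
    (k : ℕ → ℝ) (hk : B.mem k) (v : Fin n → ℝ) : (lam : ℝ) * (v ⬝ᵥ v) ≤ v ⬝ᵥ (rexprMatrix n E k *ᵥ v) := by
  refine KdCert.sound (P := fun k ↦ ∀ v : Fin n → ℝ, (lam : ℝ) * (v ⬝ᵥ v) ≤ v ⬝ᵥ (rexprMatrix n E k *ᵥ v))
    (fun B l hl k hk v ↦ ?_) t B h k hk v
  simp only [symLeafOK, Bool.and_eq_true, decide_eq_true_eq] at hl
  obtain ⟨⟨h1, h2⟩, h3⟩ := hl
  refine le_trans ?_ (mul_dotProduct_le_of_checkLower h3 (rexprEntryOK_sound h1 k hk) v)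
  refine mul_le_mul_of_nonneg_right (by exact_mod_cast h2) ?_
  simp only [dotProduct]
  exact Finset.sum_nonneg fun i _ ↦ mul_self_nonneg _

/-- **Certified eigenvalue scan (complex Hermitian `RExpr` family).** [folklore] -/
theorem le_eigenvalues_rexprMatrixC_of_kdCheck {n : ℕ} {Ere Eim : List (List RExpr)}
    (hherm : ∀ k, (rexprMatrixC n Ere Eim k).IsHermitian) {lam : ℚ} {B : Box}
    {t : KdCert (HermLeaf (ℕ × ℕ))} (h : t.check (hermLeafOK n (rexprEntryOKC n Ere Eim) lam) B = true)
    (k : ℕ → ℝ) (hk : B.mem k) (i : Fin n) : (lam : ℝ) ≤ (hherm k).eigenvalues i :=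
  le_eigenvalues_on_box_of_kdCheck hherm (fun _ _ hl k hk i j ↦ rexprEntryOKC_sound hl k hk i j) h k hk i

/-- **Certified form scan (complex `RExpr` family, no symmetry needed)**. [folklore] -/
theorem mul_normSq_le_re_rexprMatrixC_of_kdCheck {n : ℕ} {Ere Eim : List (List RExpr)} {lam : ℚ}
    {B : Box} {t : KdCert (HermLeaf (ℕ × ℕ))}
    (h : t.check (hermLeafOK n (rexprEntryOKC n Ere Eim) lam) B = true) (k : ℕ → ℝ) (hk : B.mem k)
    (v : Fin n → ℂ) : (lam : ℝ) * ∑ i, ‖v i‖ ^ 2 ≤ RCLike.re (star v ⬝ᵥ (rexprMatrixC n Ere Eim k *ᵥ v)) :=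
  mul_normSq_le_re_on_box_of_kdCheck (fun _ _ hl k hk i j ↦ rexprEntryOKC_sound hl k hk i j) h k hk v

/-! ### Kernel example -/

/-- The family `A(x) = [[2, x], [x, 2]]`, `x ∈ [0, 1]`, has `λ_min = 2 − x ≥ 1`. Two cells suffice to
certify `λ_min ≥ 9/10`: on `[0, ½]` the entries are `2 ± 0`, `¼ ± ¼` and Gershgorin gives `3/2`; on
`[½, 1]` they are `¾ ± ¼` and Gershgorin gives `1`. -/
example : (KdCert.split 0 (1/2)
      (.leaf (⟨[[2, 1/4], [1/4, 2]], [[0, 1/4], [1/4, 0]], ⟨3/2, 0, [], []⟩, (10, 0)⟩ : SymLeaf (ℕ × ℕ)))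
      (.leaf ⟨[[2, 3/4], [3/4, 2]], [[0, 1/4], [1/4, 0]], ⟨1, 0, [], []⟩, (10, 0)⟩)).check
    (symLeafOK 2 (rexprEntryOK 2 [[.const 2, .var 0], [.var 0, .const 2]]) (9/10)) [(0, 1)] = true := by
  decide +kernel

end Literature.Analysis.ValidatedNumerics

end
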